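import Summits.PneNP.PneNP.Theorems.UniformStreamUniformMagnificationVariants160474
import Literature.Computability.Complexity.EasyWitnessSearch
import HarnessLib

/-!
# Route UniformStream, crux `UniformMagnification` (stmt-PneNP-16047), line `registered`,
# stub `stub_searchStream`, part C: one step of the compressor is correct

Continuing parts A and B (`UniformStreamUniformMagnificationVariants160473/4.lean`: the relation
`SearchStream.Rel`, its search function `g`, the maps `core`/`delta`/`iota` and the canonical live
states `liveWord`), this file proves the two halves of the Nerode-type invariant of
McKay–Murray–Williams' Algorithm 1 (block length `1`) for ONE query
`q = ⟨⟨⟨u, v⟩, ⟨Pw, Df⟩⟩, cb⟩` at position `P = val Pw` with current program `D = fstP Df`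
(`n = |u|`, `t = |v|`; "good" = the certificate predicate of `stub_goodProg`, whose soundness and
completeness clauses are the hypotheses `hsound`, `hcomplete`; row `i` of a program is its answer on
the point `lowBits n i`, the order of `truthTable`):

* `SearchStream.rel_of_function` — if some function of complexity `≤ t` agrees with `D` on the rows
  `< P` (and answers `cb` on row `P`), then `q` has a solution of `Rel` within the width
  (completeness gives a short good program of that function; its rows are the function's values);
* `SearchStream.extends_of_rel` — a solution `D'` of `Rel` is good, short, agrees with `D` on the
  rows `< P` and answers `cb` on row `P` (rows `i ≤ P < 2ⁿ` are addressed by the words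
  `ofFn (lowBits n i)` of value `i`);
* `SearchStream.core_live_step` / `SearchStream.core_init_step` — hence, by the specification of the
  search function `g`, from a live state whose program extends the prefix `p` the next search
  either returns a good short program extending `p ++ [b]`, or fails exactly when NO function of
  complexity `≤ t` extends `p ++ [b]`; and likewise for the first search (prefix `ε`).

References: D. M. McKay, C. D. Murray, R. R. Williams, *Weak lower bounds on resource-bounded
compression imply strong separations of complexity classes*, STOC 2019, §4 (Algorithm 1, proof of
Thm. 1.2); S. Arora, B. Barak, *Computational Complexity: A Modern Approach*, CUP 2009, Thm. 2.18.
-/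

namespace Summit.PneNP.PneNP.Cruxes.UniformMagnification.Birth

set_option linter.dupNamespace false -- `Summit.PneNP.PneNP.…`: summit = sub-problem (D-0017)

namespace SearchStream

open _root_.Computability
open Literature.Computability.Complexity Literature.Computability.MetaComplexity
-- BEGIN BODY

open Literature.Computability.Complexity.CircEval Literature.Computability.MetaComplexity.MCSPVerif

/-! ### Rows of a program -/

/-- **Row `val w` of a program is its answer on `w`**: the evaluator's answer on `⟨w, D⟩` is the
value of the function of `D` at the point `lowBits |w| (val w)`. [folklore] -/
theorem evalFn_eq_row (w D : List Bool) :
    evalFn (boolPair w D) =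
      [(evalFn (boolPair (List.ofFn (lowBits w.length (bitsToNat w))) D)).headD false] := by
  rw [ofFn_lowBits_bitsToNat]
  exact EasyWitness.evalFn_eq_singleton _

/-- The word `ofFn (lowBits n i)` has value `i` for `i < 2ⁿ`. [folklore] -/
theorem bitsToNat_ofFn_lowBits_of_lt {n i : ℕ} (hi : i < 2 ^ n) :
    bitsToNat (List.ofFn (lowBits n i)) = i := by
  rw [bitsToNat_ofFn_lowBits, Nat.mod_eq_of_lt hi]

section Step

variable
  (hcomplete : ∀ (n t : ℕ) (f : (Fin n → Bool) → Bool), circuitSizeOver B2 f ≤ t →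
    ∃ D : List Bool, CircEval.isClean D = true ∧
      (CircEval.tabCount D ≤ t ∧ t ≠ 0 ∨ ∃ k < n, D = CircEval.rotCode k) ∧
      (fun x : Fin n → Bool => (CircEval.evalFn (boolPair (List.ofFn x) D)).headD false) = f ∧
      D.length ≤ (t + 1) * (8 * (n + t) + 10) + 2 * n)
  {g : List Bool → List Bool}
  (hg : ∀ q : List Bool, (∃ y : List Bool, y.length ≤ Wp.eval q.length ∧ boolPair q y ∈ Rel) →
    (g q).length ≤ Wp.eval q.length ∧ boolPair q (g q) ∈ Rel)

/-! ### From a small consistent function to a solution of the relation -/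

include hcomplete in
/-- **Completeness of the relation.** If a function `f` of complexity `≤ t = |v|` agrees with the
current program `D = fstP Df` on the rows `< P = val Pw` and answers `cb` on row `P` (when
`cb ≠ ε`), then the query `q = ⟨⟨⟨u, v⟩, ⟨Pw, Df⟩⟩, cb⟩` has a solution of `Rel` of length
`≤ W(|q|)` — the short good program of `f` given by completeness of good programs.
[cite: MckayMurrayWilliams2019, §4 (Algorithm 1, proof of Thm. 1.2)] -/
theorem rel_of_function (u v Pw Df cb : List Bool) (f : (Fin u.length → Bool) → Bool)
    (hf : circuitSizeOver B2 f ≤ v.length)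
    (hlow : ∀ i < bitsToNat Pw,
      f (lowBits u.length i) = (evalFn (boolPair (List.ofFn (lowBits u.length i)) (fstP Df))).headD false)
    (hrow : ¬ cb = [] → [f (lowBits u.length (bitsToNat Pw))] = cb) :
    ∃ y : List Bool, y.length ≤ Wp.eval (boolPair (boolPair (boolPair u v) (boolPair Pw Df)) cb).length ∧
      boolPair (boolPair (boolPair (boolPair u v) (boolPair Pw Df)) cb) y ∈ Rel := by
  obtain ⟨E, hE, hgood, hEf, hElen⟩ := hcomplete u.length v.length f hf
  have hfun : ∀ x : Fin u.length → Bool, (evalFn (boolPair (List.ofFn x) E)).headD false = f x :=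
    fun x => congrFun hEf x
  have hW : E.length ≤ Wp.eval (boolPair u v).length := hElen.trans (goodWidth_le u v)
  refine ⟨E, hW.trans (Wp_mono (by simp only [length_boolPair]; omega)), ?_⟩
  rw [boolPair_mem_Rel_iff]
  refine ⟨hW, (boolPair_mem_GoodL_iff u v E).2 ⟨hE, hgood⟩, fun w _ hw => ?_⟩
  rw [fstP_boolPair] at hw
  constructor
  · intro hlt
    rw [evalFn_eq_row w E, evalFn_eq_row w (fstP Df), hw, hfun, hlow _ hlt]
  · intro hcb heq
    rw [evalFn_eq_row w E, hw, hfun, heq, hrow hcb]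

/-! ### From a solution of the relation to an extension -/

/-- **Soundness of the relation.** A solution `D'` of the query `q = ⟨⟨⟨u, v⟩, ⟨Pw, Df⟩⟩, cb⟩`
(`P = val Pw < 2ⁿ`, `n = |u|`) is a good program of length `≤ W(|⟨u, v⟩|)` that agrees with
`D = fstP Df` on the rows `< P` and answers `cb` on row `P` (when `cb ≠ ε`).
[cite: MckayMurrayWilliams2019, §4 (Algorithm 1, proof of Thm. 1.2)] -/
theorem extends_of_rel (u v Pw Df cb D' : List Bool) (hP : bitsToNat Pw < 2 ^ u.length)
    (hR : boolPair (boolPair (boolPair (boolPair u v) (boolPair Pw Df)) cb) D' ∈ Rel) :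
    boolPair (boolPair u v) D' ∈ GoodL ∧ D'.length ≤ Wp.eval (boolPair u v).length ∧
      (∀ i < bitsToNat Pw, (evalFn (boolPair (List.ofFn (lowBits u.length i)) D')).headD false =
        (evalFn (boolPair (List.ofFn (lowBits u.length i)) (fstP Df))).headD false) ∧
      (¬ cb = [] → [(evalFn (boolPair (List.ofFn (lowBits u.length (bitsToNat Pw))) D')).headD false] = cb) := by
  rw [boolPair_mem_Rel_iff] at hR
  obtain ⟨hW, hgood, hall⟩ := hR
  have hrow : ∀ i ≤ bitsToNat Pw,
      (i < bitsToNat Pw → evalFn (boolPair (List.ofFn (lowBits u.length i)) D') =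
        evalFn (boolPair (List.ofFn (lowBits u.length i)) (fstP Df))) ∧
      (¬ cb = [] → i = bitsToNat Pw → evalFn (boolPair (List.ofFn (lowBits u.length i)) D') = cb) := by
    intro i hi
    have hval : bitsToNat (List.ofFn (lowBits u.length i)) = i :=
      bitsToNat_ofFn_lowBits_of_lt (by omega)
    have h := hall (List.ofFn (lowBits u.length i))
      (by simp only [List.length_ofFn, length_boolPair]; omega)
      (by rw [List.length_ofFn, fstP_boolPair])
    rwa [hval] at h
  refine ⟨hgood, hW, fun i hi => ?_, fun hcb => ?_⟩
  · rw [((hrow i hi.le).1 hi)]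
  · rw [← (hrow _ le_rfl).2 hcb rfl]
    exact (EasyWitness.evalFn_eq_singleton _).symm

/-! ### One step of the compressor -/

include hcomplete hg in
/-- **The step dichotomy.** From a live state at parameters `u, v` whose good program `D` extends
the prefix `p` (`|p| + 1 ≤ 2ⁿ`), on the bit `b` the search on `q = ⟨body, [b]⟩` either succeeds —
`⟨q, g q⟩ ∈ Rel` and `g q` is a good short program extending `p ++ [b]` — or fails, and then NO
function of complexity `≤ t` extends `p ++ [b]`.
[cite: MckayMurrayWilliams2019, §4 (Algorithm 1, proof of Thm. 1.2)] -/
theorem core_live_step (u v p D : List Bool) (b : Bool) (hp : p.length + 1 ≤ 2 ^ u.length)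
    (hext : ∀ (i : ℕ) (hi : i < p.length),
      (evalFn (boolPair (List.ofFn (lowBits u.length i)) D)).headD false = p[i])
    (q : List Bool) (hq : q = boolPair (sndP (liveWord u v p.length D)) [b]) :
    (boolPair q (g q) ∈ Rel ∧ boolPair (boolPair u v) (g q) ∈ GoodL ∧
        (g q).length ≤ Wp.eval (boolPair u v).length ∧
        ∀ (i : ℕ) (hi : i < (p ++ [b]).length),
          (evalFn (boolPair (List.ofFn (lowBits u.length i)) (g q))).headD false = (p ++ [b])[i]) ∨
      (boolPair q (g q) ∉ Rel ∧
        ¬ ∃ f : (Fin u.length → Bool) → Bool, circuitSizeOver B2 f ≤ v.length ∧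
          ∀ (i : ℕ) (hi : i < (p ++ [b]).length), f (lowBits u.length i) = (p ++ [b])[i]) := by
  have hn : 2 ^ u.length < 2 ^ (u.length + 1) := Nat.pow_lt_pow_right (by omega) (by omega)
  have hval : bitsToNat ((encodeNat p.length).takeD (u.length + 1) false) = p.length := by
    rw [bitsToNat_takeD, bitsToNat_encodeNat, Nat.mod_eq_of_lt (by omega)]
  rw [sndP_liveWord] at hq
  subst hq
  by_cases hR : boolPair (boolPair (boolPair (boolPair u v)
      (boolPair ((encodeNat p.length).takeD (u.length + 1) false)
        (boolPair D (List.replicate (2 * Wp.eval (boolPair u v).length - 2 * D.length) true)))) [b])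
      (g (boolPair (boolPair (boolPair u v)
      (boolPair ((encodeNat p.length).takeD (u.length + 1) false)
        (boolPair D (List.replicate (2 * Wp.eval (boolPair u v).length - 2 * D.length) true)))) [b])) ∈ Rel
  · left
    obtain ⟨hgood, hW, hlow, hrowP⟩ := extends_of_rel _ _ _ _ _ _ (by rw [hval]; omega) hR
    rw [hval, fstP_boolPair] at hlow
    rw [hval] at hrowP
    refine ⟨hR, hgood, hW, fun i hi => ?_⟩
    rw [List.length_append, List.length_singleton] at hi
    rcases Nat.lt_or_ge i p.length with hlt | hge
    · rw [List.getElem_append_left hlt, hlow i hlt, hext i hlt]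
    · have hi' : i = p.length := by omega
      subst hi'
      have h := hrowP (List.cons_ne_nil b [])
      rw [List.getElem_concat_length rfl]
      exact (List.cons.inj h).1
  · right
    refine ⟨hR, ?_⟩
    rintro ⟨f, hf, hfext⟩
    refine hR (hg _ (rel_of_function hcomplete u v _ _ [b] f hf (fun i hi => ?_) (fun _ => ?_))).2
    · rw [hval] at hi
      rw [fstP_boolPair, hext i hi, hfext i (by rw [List.length_append]; omega),
        List.getElem_append_left hi]
    · rw [hval, hfext p.length (by simp), List.getElem_concat_length rfl]

include hcomplete hg in
/-- **The first-step dichotomy.** On the first query `q = ssQ0 ⟨⟨u, v⟩, x⟩` (position `0`, no row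
constraint) the search either succeeds — `⟨q, g q⟩ ∈ Rel` and `g q` is a good short program — or
fails, and then NO function at all has complexity `≤ t`.
[cite: MckayMurrayWilliams2019, §4 (Algorithm 1, proof of Thm. 1.2)] -/
theorem core_init_step (u v x : List Bool) (q : List Bool) (hq : q = ssQ0 (boolPair (boolPair u v) x)) :
    (boolPair q (g q) ∈ Rel ∧ boolPair (boolPair u v) (g q) ∈ GoodL ∧
        (g q).length ≤ Wp.eval (boolPair u v).length) ∨
      (boolPair q (g q) ∉ Rel ∧
        ¬ ∃ f : (Fin u.length → Bool) → Bool, circuitSizeOver B2 f ≤ v.length) := by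
  have hval : bitsToNat (List.replicate (u.length + 1) false) = 0 := bitsToNat_replicate_false _
  rw [ssQ0_apply] at hq
  subst hq
  by_cases hR : boolPair (boolPair (boolPair (boolPair u v)
      (boolPair (List.replicate (u.length + 1) false) (boolPair [] []))) [])
      (g (boolPair (boolPair (boolPair u v)
      (boolPair (List.replicate (u.length + 1) false) (boolPair [] []))) [])) ∈ Rel
  · left
    obtain ⟨hgood, hW, -, -⟩ := extends_of_rel _ _ _ _ _ _ (by rw [hval]; exact Nat.two_pow_pos _) hR
    exact ⟨hR, hgood, hW⟩
  · right
    refine ⟨hR, ?_⟩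
    rintro ⟨f, hf⟩
    refine hR (hg _ (rel_of_function hcomplete u v _ _ [] f hf (fun i hi => ?_) (fun h => ?_))).2
    · rw [hval] at hi
      exact absurd hi (Nat.not_lt_zero i)
    · exact absurd rfl h

end Step

end SearchStream

end Summit.PneNP.PneNP.Cruxes.UniformMagnification.Birth
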